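import Mathlib
import HarnessLib

/-!
# Holomorphic infinite products: the Weierstrass `M`-test (direct form) — convergence, size, tails,
# holomorphy, continuation between half-planes, and the `O(D^{−δ})` prime tails of Euler products

Topic `Literature/Analysis/Complex` (generic, refereed-textbook material, PROVED — no named facts; ZHANG-L
LIB-PLAN §2 item D1 = LIB-QUEUE Q-04 = LIBC-INVENTORY §T5; names E1–E5 per zl-lib-1's sketch). The package
behind every "the Euler product converges absolutely, is analytic for `σ > σ₀`, and equals its truncation at
the primes `q < D` up to `O(D^{−c})`" (e.g. Zhang arXiv:2211.02515 App. A p.101 `𝒰_j`, §15 p.84 `𝓜₁`,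
Lemma 16.2), for any index type `ι` and a summable majorant `b` of `‖F i − 1‖`:
* finite products: `norm_prod_sub_one_le_exp_sub_one`, `norm_prod_le_exp_sum`,
  `norm_prod_le_exp_tsum_of_norm_sub_one_le` (real helper `eˣ − 1 ≤ x eˣ` private; use Mathlib `Real.abs_exp_sub_one_le`);
* scalar factors `F : ι → ℂ`: `multipliable_of_summable_norm_sub_one`, `multipliable_of_norm_sub_one_le_const`,
  `tprod_ne_zero_of_summable_norm_sub_one`; TAILS `norm_hasProd_sub_prod_le`, `norm_tprod_sub_prod_le_of_multipliable`
  (`‖∏' F − ∏_{i∈S} F i‖ ≤ ‖∏_S F‖·(exp(Σ' b) − 1)` when `‖F i − 1‖ ≤ b i` OFF `S`; put `b = 0` on `S` for the sharp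
  form), `norm_tprod_sub_prod_le_mul_tsum`; SIZE `norm_tprod_le_of_forall_norm_prod_le`,
  `le_norm_tprod_of_forall_le_norm_prod`, `norm_tprod_le_exp_tsum_const`, `norm_tprod_sub_one_le_const`;
* families `F : ι → ℂ → ℂ` on a set `U` (E1–E5): `multipliable_of_norm_sub_one_le`, `tendstoUniformlyOn_prod_tprod`
  (partial products converge UNIFORMLY on `U`: `‖∏' − ∏_A‖ ≤ e^{Σ'b}(e^{Σ_{i∉A}b} − 1) → 0`),
  `hasProd[Locally]UniformlyOn_of_norm_sub_one_le`, **`differentiableOn_tprod_of_norm_sub_one_le`** (Conway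
  VII.5.9), `norm_tprod_le_exp_tsum`, `norm_tprod_sub_one_le_exp_tsum_sub_one`, `tprod_ne_zero_of_norm_sub_one_le`,
  `norm_tprod_sub_prod_le`;
* continuation (identity theorem, Conway IV.3.8): `eqOn_of_eqOn_halfPlane` (holomorphic on `{σ₀ < Re s}`, equal on `{σ₁ < Re s}` ⇒ equal),
  `eqOn_tprod_of_eqOn_halfPlane` ("`𝒰(s)`, the product for `σ > 1`, IS the holomorphic `∏'` on `σ > 9/10`");
* prime tails (E6): `primeTail_nonneg`, `summable_primeTail`, `tsum_primeTail_le` (`Σ_{q≥D} C q^{−(a+δ)} ≤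
  C D^{−δ} Σ_q q^{−a}`; `Nat.Primes.summable_rpow`), **`norm_tprod_primes_sub_prod_primesBelow_le`**
  (`‖f q − 1‖ ≤ C q^{−(a+δ)}` for primes `q ≥ D` ⇒ `‖∏'_q f q − ∏_{q<D} f q‖ ≤ ‖∏_{q<D} f q‖·(exp(C D^{−δ} Σ_q q^{−a}) − 1)`).
Previously private/inline in `Zhang2022/Section15BCalM1Analytic` :373/:405, `Zhang2022/AppendixAEqA4` :83,
`Zhang2022/Section3PhiFlat` :387, `Section3PhiStar` :425, `TypedSection16B` :902/:1964,
`LFunctions/TwistedRankinSelbergEulerValueHolomorphy` :163; the public INVERSE form (entire factors) is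
`Literature.NumberTheory.Automorphic.AsaiSignProofs.differentiableOn_tprod_inv_of_norm_sub_one_le` (not restated).
NOT HERE: the compact-subset version of E2 (Mathlib `Summable.hasProdLocallyUniformlyOn_one_add` route),
logarithms of products, Euler products of specific arithmetic functions (Mathlib `EulerProduct.*`).

## References
* J. B. Conway, *Functions of One Complex Variable I*, GTM 11 (1978), VII §5: Lemma 5.8, Theorem 5.9,
  Cor. 5.6. [cite: Conway1978, VII.5.9]
* E. C. Titchmarsh, *The Theory of Functions*, 2nd ed. (1939), §§1.43–1.44. [cite: Titchmarsh1939, §1.44]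
-/

noncomputable section

open Filter Topology

namespace Literature.Analysis.Complex

/-! ## Finite products of factors close to `1` -/

/-- `‖∏_{i∈A} F(i) − 1‖ ≤ exp(Σ_{i∈A} ‖F(i) − 1‖) − 1` (Mathlib's `Finset.norm_prod_one_add_sub_one_le`
with `f = F − 1`). [cite: Conway1978, VII.5 Lemma 5.8] -/
theorem norm_prod_sub_one_le_exp_sub_one {ι : Type*} (A : Finset ι) (F : ι → ℂ) :
    ‖∏ i ∈ A, F i - 1‖ ≤ Real.exp (∑ i ∈ A, ‖F i - 1‖) - 1 := by
  have h := A.norm_prod_one_add_sub_one_le (fun i => F i - 1)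
  simpa only [add_sub_cancel] using h

/-- `‖∏_{i∈A} F(i)‖ ≤ exp(Σ_{i∈A} ‖F(i) − 1‖)`. [cite: Conway1978, VII.5 Lemma 5.8] -/
theorem norm_prod_le_exp_sum {ι : Type*} (A : Finset ι) (F : ι → ℂ) :
    ‖∏ i ∈ A, F i‖ ≤ Real.exp (∑ i ∈ A, ‖F i - 1‖) := by
  have h1 := norm_prod_sub_one_le_exp_sub_one A F
  have h2 : ‖∏ i ∈ A, F i‖ ≤ ‖∏ i ∈ A, F i - 1‖ + ‖(1 : ℂ)‖ := by
    have := norm_add_le (∏ i ∈ A, F i - 1) 1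
    rwa [sub_add_cancel] at this
  rw [norm_one] at h2
  linarith

/-- `‖∏_{i∈A} F(i)‖ ≤ exp B` whenever `‖F i − 1‖ ≤ b i` on `A`, `b ≥ 0` summable with `Σ' b ≤ B`.
[cite: Conway1978, VII.5 Lemma 5.8] -/
theorem norm_prod_le_exp_tsum_of_norm_sub_one_le {ι : Type*} (A : Finset ι) {F : ι → ℂ} {b : ι → ℝ}
    (hb0 : ∀ i, 0 ≤ b i) (hb : Summable b) (hFb : ∀ i ∈ A, ‖F i - 1‖ ≤ b i) :
    ‖∏ i ∈ A, F i‖ ≤ Real.exp (∑' i, b i) := by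
  refine (norm_prod_le_exp_sum A F).trans (Real.exp_le_exp.mpr ?_)
  calc ∑ i ∈ A, ‖F i - 1‖ ≤ ∑ i ∈ A, b i := Finset.sum_le_sum hFb
    _ ≤ ∑' i, b i := hb.sum_le_tsum _ (fun i _ => hb0 i)

/-- `eˣ − 1 ≤ x·eˣ` (from `1 − x ≤ e^{−x}`); turns `exp(ε) − 1` tails into `O(ε)` (consumers: Mathlib
`Real.abs_exp_sub_one_le : |x| ≤ 1 → |exp x − 1| ≤ 2|x|` and `Real.add_one_le_exp`). [folklore] -/
private theorem exp_sub_one_le_self_mul_exp (x : ℝ) : Real.exp x - 1 ≤ x * Real.exp x := by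
  have h := Real.add_one_le_exp (-x)
  have hpos := Real.exp_pos x
  have h1 : (1 - x) * Real.exp x ≤ Real.exp (-x) * Real.exp x :=
    mul_le_mul_of_nonneg_right (by linarith) hpos.le
  rw [← Real.exp_add, neg_add_cancel, Real.exp_zero] at h1
  nlinarith

/-! ## Convergence and non-vanishing of `∏' i, F i` (scalar factors) -/

/-- If `Σ ‖F i − 1‖ < ∞` then `∏' i, F i` converges unconditionally (Mathlib
`multipliable_one_add_of_summable`). [cite: Conway1978, VII.5 Cor. 5.6] -/
theorem multipliable_of_summable_norm_sub_one {ι : Type*} {F : ι → ℂ}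
    (h : Summable fun i => ‖F i - 1‖) : Multipliable F := by
  have h' := multipliable_one_add_of_summable h
  simpa only [add_sub_cancel] using h'

/-- If `‖F i − 1‖ ≤ b i` with `b` summable then `∏' i, F i` converges unconditionally.
[cite: Conway1978, VII.5 Cor. 5.6] -/
theorem multipliable_of_norm_sub_one_le_const {ι : Type*} {F : ι → ℂ} {b : ι → ℝ} (hb : Summable b)
    (hFb : ∀ i, ‖F i - 1‖ ≤ b i) : Multipliable F :=
  multipliable_of_summable_norm_sub_one
    (Summable.of_nonneg_of_le (fun _ => norm_nonneg _) hFb hb)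

/-- If `Σ ‖F i − 1‖ < ∞` and no factor vanishes, `∏' i, F i ≠ 0` (Mathlib
`tprod_one_add_ne_zero_of_summable`). [cite: Conway1978, VII.5 Theorem 5.9] -/
theorem tprod_ne_zero_of_summable_norm_sub_one {ι : Type*} {F : ι → ℂ}
    (h : Summable fun i => ‖F i - 1‖) (h0 : ∀ i, F i ≠ 0) : ∏' i, F i ≠ 0 := by
  have h' := tprod_one_add_ne_zero_of_summable (f := fun i => F i - 1)
    (fun i => by simpa only [add_sub_cancel] using h0 i) h
  simpa only [add_sub_cancel] using h'

/-! ## Tails: the product versus a finite partial product (scalar factors) -/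

/-- **Tail control for an unconditional product.** If `HasProd F a`, `S` is a finite set, `b ≥ 0`
is summable and `‖F(i) − 1‖ ≤ b(i)` for `i ∉ S`, then
`‖a − ∏_{i∈S} F(i)‖ ≤ ‖∏_{i∈S} F(i)‖ · (exp(Σ' b) − 1)`: every partial product over a finite
`A ⊇ S` is `∏_S F · ∏_{A∖S} F` with `‖∏_{A∖S} F − 1‖ ≤ exp(Σ_{A∖S} b) − 1 ≤ exp(Σ' b) − 1`, and the
closed ball passes to the limit along `atTop`. (Take `b = 0` on `S` to get the tail sum `Σ_{i∉S} b`.)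
[cite: Conway1978, VII.5 Lemma 5.8] -/
theorem norm_hasProd_sub_prod_le {ι : Type*} {F : ι → ℂ} {a : ℂ} (hF : HasProd F a)
    (S : Finset ι) {b : ι → ℝ} (hb0 : ∀ i, 0 ≤ b i) (hb : Summable b)
    (hFb : ∀ i ∉ S, ‖F i - 1‖ ≤ b i) :
    ‖a - ∏ i ∈ S, F i‖ ≤ ‖∏ i ∈ S, F i‖ * (Real.exp (∑' i, b i) - 1) := by
  classical
  set P := ∏ i ∈ S, F i with hPdef
  set R := ‖P‖ * (Real.exp (∑' i, b i) - 1) with hRdef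
  have hA : ∀ A : Finset ι, S ≤ A → ‖∏ i ∈ A, F i - P‖ ≤ R := by
    intro A hSA
    have hsplit : ∏ i ∈ A, F i = P * ∏ i ∈ A \ S, F i := by
      rw [hPdef, ← Finset.prod_sdiff hSA, mul_comm]
    have h1 : ‖∏ i ∈ A \ S, F i - 1‖ ≤ Real.exp (∑' i, b i) - 1 := by
      refine (norm_prod_sub_one_le_exp_sub_one _ _).trans ?_
      have hle : ∑ i ∈ A \ S, ‖F i - 1‖ ≤ ∑' i, b i :=
        calc ∑ i ∈ A \ S, ‖F i - 1‖ ≤ ∑ i ∈ A \ S, b i :=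
              Finset.sum_le_sum fun i hi => hFb i (Finset.mem_sdiff.mp hi).2
          _ ≤ ∑' i, b i := hb.sum_le_tsum _ (fun i _ => hb0 i)
      linarith [Real.exp_le_exp.mpr hle]
    calc ‖∏ i ∈ A, F i - P‖ = ‖P * (∏ i ∈ A \ S, F i - 1)‖ := by rw [hsplit]; ring_nf
      _ = ‖P‖ * ‖∏ i ∈ A \ S, F i - 1‖ := norm_mul _ _
      _ ≤ R := mul_le_mul_of_nonneg_left h1 (norm_nonneg _)
  have hT : Tendsto (fun A : Finset ι => ∏ i ∈ A, F i) atTop (𝓝 a) := hF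
  have hclosed : IsClosed {z : ℂ | ‖z - P‖ ≤ R} :=
    isClosed_le (continuous_id.sub continuous_const).norm continuous_const
  exact hclosed.mem_of_tendsto hT (Filter.eventually_atTop.mpr ⟨S, fun A hA' => hA A hA'⟩)

/-- **Tail of a convergent product**: `‖∏' F − ∏_{i∈S} F i‖ ≤ ‖∏_{i∈S} F i‖ · (exp(Σ' b) − 1)`
whenever `‖F i − 1‖ ≤ b i` off `S`, `b ≥ 0` summable, `F` multipliable.
[cite: Conway1978, VII.5 Lemma 5.8] -/
theorem norm_tprod_sub_prod_le_of_multipliable {ι : Type*} {F : ι → ℂ} (hF : Multipliable F)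
    (S : Finset ι) {b : ι → ℝ} (hb0 : ∀ i, 0 ≤ b i) (hb : Summable b)
    (hFb : ∀ i ∉ S, ‖F i - 1‖ ≤ b i) :
    ‖(∏' i, F i) - ∏ i ∈ S, F i‖ ≤ ‖∏ i ∈ S, F i‖ * (Real.exp (∑' i, b i) - 1) :=
  norm_hasProd_sub_prod_le hF.hasProd S hb0 hb hFb

/-- Relative form of the tail bound: `‖∏' F − ∏_S F‖ ≤ ‖∏_S F‖ · (Σ' b) · exp(Σ' b)`.
[cite: Conway1978, VII.5 Lemma 5.8] -/
theorem norm_tprod_sub_prod_le_mul_tsum {ι : Type*} {F : ι → ℂ} (hF : Multipliable F)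
    (S : Finset ι) {b : ι → ℝ} (hb0 : ∀ i, 0 ≤ b i) (hb : Summable b)
    (hFb : ∀ i ∉ S, ‖F i - 1‖ ≤ b i) :
    ‖(∏' i, F i) - ∏ i ∈ S, F i‖ ≤ ‖∏ i ∈ S, F i‖ * ((∑' i, b i) * Real.exp (∑' i, b i)) :=
  (norm_tprod_sub_prod_le_of_multipliable hF S hb0 hb hFb).trans
    (mul_le_mul_of_nonneg_left (exp_sub_one_le_self_mul_exp _) (norm_nonneg _))

/-! ## Size of `∏' i, F i` (scalar factors) -/

/-- A convergent product whose finite partial products all have norm `≤ B` has norm `≤ B`;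
a non-convergent one is `1` by convention, so `1 ≤ B` covers both cases (the closed-ball passage to the
limit in the proof of the `M`-test for products). [cite: Conway1978, VII.5 Lemma 5.8 (proof), p. 166] -/
theorem norm_tprod_le_of_forall_norm_prod_le {ι : Type*} (F : ι → ℂ) {B : ℝ} (hB : 1 ≤ B)
    (h : ∀ A : Finset ι, ‖∏ i ∈ A, F i‖ ≤ B) : ‖∏' i, F i‖ ≤ B := by
  by_cases hm : Multipliable F
  · have hP : Tendsto (fun A : Finset ι => ∏ i ∈ A, F i) atTop (𝓝 (∏' i, F i)) := hm.hasProd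
    have hclosed : IsClosed {z : ℂ | ‖z‖ ≤ B} := isClosed_le continuous_norm continuous_const
    exact hclosed.mem_of_tendsto hP (Filter.Eventually.of_forall h)
  · rw [tprod_eq_one_of_not_multipliable hm, norm_one]
    exact hB

/-- A convergent product whose finite partial products all have norm `≥ c` has norm `≥ c`
(for `c > 0` this is non-vanishing with an explicit floor; closed-set passage to the limit).
[cite: Conway1978, VII.5 Lemma 5.8 (proof), p. 166] -/
theorem le_norm_tprod_of_forall_le_norm_prod {ι : Type*} {F : ι → ℂ} (hm : Multipliable F) {c : ℝ}
    (h : ∀ A : Finset ι, c ≤ ‖∏ i ∈ A, F i‖) : c ≤ ‖∏' i, F i‖ := by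
  have hP : Tendsto (fun A : Finset ι => ∏ i ∈ A, F i) atTop (𝓝 (∏' i, F i)) := hm.hasProd
  have hclosed : IsClosed {z : ℂ | c ≤ ‖z‖} := isClosed_le continuous_const continuous_norm
  exact hclosed.mem_of_tendsto hP (Filter.Eventually.of_forall h)

/-- `‖∏' F‖ ≤ exp(Σ' b)` whenever `‖F i − 1‖ ≤ b i` for all `i`, `b ≥ 0` summable.
[cite: Conway1978, VII.5 Lemma 5.8] -/
theorem norm_tprod_le_exp_tsum_const {ι : Type*} {F : ι → ℂ} {b : ι → ℝ}
    (hb : Summable b) (hFb : ∀ i, ‖F i - 1‖ ≤ b i) :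
    ‖∏' i, F i‖ ≤ Real.exp (∑' i, b i) :=
  have hb0 : ∀ i, 0 ≤ b i := fun i => (norm_nonneg _).trans (hFb i)
  norm_tprod_le_of_forall_norm_prod_le F (Real.one_le_exp (tsum_nonneg hb0))
    fun A => norm_prod_le_exp_tsum_of_norm_sub_one_le A hb0 hb (fun i _ => hFb i)

/-- `‖∏' F − 1‖ ≤ exp(Σ' b) − 1` whenever `‖F i − 1‖ ≤ b i` for all `i`, `b ≥ 0` summable (the case
`S = ∅` of the tail bound). [cite: Conway1978, VII.5 Lemma 5.8] -/
theorem norm_tprod_sub_one_le_const {ι : Type*} {F : ι → ℂ} {b : ι → ℝ}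
    (hb : Summable b) (hFb : ∀ i, ‖F i - 1‖ ≤ b i) :
    ‖(∏' i, F i) - 1‖ ≤ Real.exp (∑' i, b i) - 1 := by
  have hb0 : ∀ i, 0 ≤ b i := fun i => (norm_nonneg _).trans (hFb i)
  have h := norm_tprod_sub_prod_le_of_multipliable (multipliable_of_norm_sub_one_le_const hb hFb) ∅
    hb0 hb (fun i _ => hFb i)
  simpa using h

/-! ## Families of functions on a set `U`: the sketch's E1–E5 -/

section OnSet

variable {ι : Type*} {U : Set ℂ} {F : ι → ℂ → ℂ} {b : ι → ℝ}

/-- **E1** (pointwise convergence): `Σ b < ∞` and `‖F_i(s) − 1‖ ≤ b_i` on `U` ⇒ `∏'_i F_i(s)`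
converges for `s ∈ U` (Mathlib `multipliable_one_add_of_summable`). [cite: Conway1978, VII.5 Cor. 5.6] -/
theorem multipliable_of_norm_sub_one_le (hb : Summable b)
    (hFb : ∀ i, ∀ s ∈ U, ‖F i s - 1‖ ≤ b i) {s : ℂ} (hs : s ∈ U) :
    Multipliable fun i => F i s :=
  multipliable_of_norm_sub_one_le_const hb (fun i => hFb i s hs)

/-- **Uniform convergence of the partial products** (the quantitative heart of E3): if
`‖F i s − 1‖ ≤ b i` for all `i` and `s ∈ U`, `Σ b < ∞`, then `∏_{i∈A} F i s → ∏' i, F i s`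
UNIFORMLY on `U` along `A → atTop`: `‖∏' − ∏_A‖ ≤ e^{Σ'b}(e^{Σ_{i∉A} b i} − 1) → 0`.
[cite: Conway1978, VII.5 Lemma 5.8] -/
theorem tendstoUniformlyOn_prod_tprod (hb : Summable b) (hFb : ∀ i, ∀ s ∈ U, ‖F i s - 1‖ ≤ b i) :
    TendstoUniformlyOn (fun A s => ∏ i ∈ A, F i s) (fun s => ∏' i, F i s) atTop U := by
  classical
  have hmul : ∀ s ∈ U, Multipliable fun i => F i s := fun s hs =>
    multipliable_of_norm_sub_one_le hb hFb hs
  set B : ℝ := ∑' i, b i with hBdef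
  set T : Finset ι → ℝ := fun A => ∑' i, ((↑A : Set ι)ᶜ).indicator b i with hTdef
  have hest : ∀ (A : Finset ι), ∀ s ∈ U,
      ‖(∏' i, F i s) - ∏ i ∈ A, F i s‖ ≤ Real.exp B * (Real.exp (T A) - 1) := by
    intro A s hs
    have hb0 : ∀ i, 0 ≤ b i := fun i => (norm_nonneg _).trans (hFb i s hs)
    have hind0 : ∀ i, 0 ≤ ((↑A : Set ι)ᶜ).indicator b i := fun i =>
      Set.indicator_nonneg (fun j _ => hb0 j) i
    have hind : ∀ i ∉ A, ‖F i s - 1‖ ≤ ((↑A : Set ι)ᶜ).indicator b i := by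
      intro i hi
      rw [Set.indicator_of_mem (by simpa using hi)]
      exact hFb i s hs
    have h1 := norm_tprod_sub_prod_le_of_multipliable (hmul s hs) A hind0 (hb.indicator _) hind
    have hP : ‖∏ i ∈ A, F i s‖ ≤ Real.exp B :=
      norm_prod_le_exp_tsum_of_norm_sub_one_le A hb0 hb (fun i _ => hFb i s hs)
    have hT0 : 0 ≤ Real.exp (T A) - 1 := by
      have : 0 ≤ T A := tsum_nonneg hind0
      linarith [Real.add_one_le_exp (T A)]
    exact h1.trans (mul_le_mul_of_nonneg_right hP hT0)
  have hTlim : Tendsto T atTop (𝓝 0) := by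
    have h := tendsto_tsum_compl_atTop_zero b
    refine h.congr fun A => ?_
    rw [hTdef]
    exact (tsum_subtype ((↑A : Set ι)ᶜ) b)
  have hglim : Tendsto (fun A => Real.exp B * (Real.exp (T A) - 1)) atTop (𝓝 0) := by
    have h1 : Tendsto (fun A => Real.exp (T A)) atTop (𝓝 (Real.exp 0)) :=
      (Real.continuous_exp.tendsto 0).comp hTlim
    rw [Real.exp_zero] at h1
    have h2 : Tendsto (fun A => Real.exp (T A) - 1) atTop (𝓝 (1 - 1)) := h1.sub_const 1
    rw [sub_self] at h2
    simpa using h2.const_mul (Real.exp B)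
  rw [Metric.tendstoUniformlyOn_iff]
  intro ε hε
  filter_upwards [hglim.eventually (gt_mem_nhds hε)] with A hA s hs
  rw [dist_eq_norm]
  exact (hest A s hs).trans_lt hA

/-- **E3, uniform form**: `HasProdUniformlyOn F (∏' ·) U` under the summable majorant.
[cite: Conway1978, VII.5 Lemma 5.8] -/
theorem hasProdUniformlyOn_of_norm_sub_one_le (hb : Summable b)
    (hFb : ∀ i, ∀ s ∈ U, ‖F i s - 1‖ ≤ b i) :
    HasProdUniformlyOn F (fun s => ∏' i, F i s) U :=
  hasProdUniformlyOn_iff_tendstoUniformlyOn.mpr (tendstoUniformlyOn_prod_tprod hb hFb)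

/-- **E3** (locally uniform convergence of the product on `U`; no openness or continuity is needed
under a uniform majorant). [cite: Conway1978, VII.5 Lemma 5.8] -/
theorem hasProdLocallyUniformlyOn_of_norm_sub_one_le (hb : Summable b)
    (hFb : ∀ i, ∀ s ∈ U, ‖F i s - 1‖ ≤ b i) :
    HasProdLocallyUniformlyOn F (fun s => ∏' i, F i s) U :=
  hasProdLocallyUniformlyOn_iff_tendstoLocallyUniformlyOn.mpr
    (tendstoUniformlyOn_prod_tprod hb hFb).tendstoLocallyUniformlyOn

/-- **E2 · Weierstrass `M`-test for holomorphic products (direct form)** (Conway VII.5.9,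
uniformly-majorised form). If each `F i` is holomorphic on an open `U ⊆ ℂ`, `Σ b < ∞` and
`‖F i s − 1‖ ≤ b i` for all `i` and `s ∈ U`, then `s ↦ ∏' i, F i s` is holomorphic on `U`.
[cite: Conway1978, VII.5 Theorem 5.9] -/
theorem differentiableOn_tprod_of_norm_sub_one_le (hU : IsOpen U)
    (hF : ∀ i, DifferentiableOn ℂ (F i) U) (hb : Summable b)
    (hFb : ∀ i, ∀ s ∈ U, ‖F i s - 1‖ ≤ b i) :
    DifferentiableOn ℂ (fun s => ∏' i, F i s) U := by
  classical
  refine (tendstoUniformlyOn_prod_tprod hb hFb).tendstoLocallyUniformlyOn.differentiableOn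
    (Filter.Eventually.of_forall fun A => ?_) hU
  exact DifferentiableOn.fun_finsetProd fun i _ => hF i

/-- **E4** (size): `‖∏'_i F_i(s)‖ ≤ exp(Σ_i b_i)` for `s ∈ U`. [cite: Conway1978, VII.5 Lemma 5.8] -/
theorem norm_tprod_le_exp_tsum (hb : Summable b) (hFb : ∀ i, ∀ s ∈ U, ‖F i s - 1‖ ≤ b i)
    {s : ℂ} (hs : s ∈ U) : ‖∏' i, F i s‖ ≤ Real.exp (∑' i, b i) :=
  norm_tprod_le_exp_tsum_const hb (fun i => hFb i s hs)

/-- **E4′** (distance from `1`): `‖∏'_i F_i(s) − 1‖ ≤ exp(Σ_i b_i) − 1` for `s ∈ U`.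
[cite: Conway1978, VII.5 Lemma 5.8] -/
theorem norm_tprod_sub_one_le_exp_tsum_sub_one (hb : Summable b)
    (hFb : ∀ i, ∀ s ∈ U, ‖F i s - 1‖ ≤ b i) {s : ℂ} (hs : s ∈ U) :
    ‖∏' i, F i s - 1‖ ≤ Real.exp (∑' i, b i) - 1 :=
  norm_tprod_sub_one_le_const hb (fun i => hFb i s hs)

/-- **Non-vanishing**: if in addition no factor vanishes on `U`, the product does not vanish on `U`
(Mathlib `tprod_one_add_ne_zero_of_summable`). [cite: Conway1978, VII.5 Theorem 5.9] -/
theorem tprod_ne_zero_of_norm_sub_one_le (hb : Summable b)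
    (hFb : ∀ i, ∀ s ∈ U, ‖F i s - 1‖ ≤ b i) (hF0 : ∀ i, ∀ s ∈ U, F i s ≠ 0)
    {s : ℂ} (hs : s ∈ U) : ∏' i, F i s ≠ 0 :=
  tprod_ne_zero_of_summable_norm_sub_one
    (Summable.of_nonneg_of_le (fun _ => norm_nonneg _) (fun i => hFb i s hs) hb)
    (fun i => hF0 i s hs)

/-- **E5** (tail control, the form App. A of Zhang (2022) uses: "the product over `q ∉ A` is
`1 + O(Σ_{q∉A} b_q)`"): for a finite set `A` and `s ∈ U`,
`‖∏'_i F_i(s) − ∏_{i∈A} F_i(s)‖ ≤ exp(Σ_i b_i)·(exp(Σ_{i∉A} b_i) − 1)`.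
[cite: Conway1978, VII.5 Lemma 5.8] -/
theorem norm_tprod_sub_prod_le (hb : Summable b) (hb0 : ∀ i, 0 ≤ b i)
    (hFb : ∀ i, ∀ s ∈ U, ‖F i s - 1‖ ≤ b i) (A : Finset ι) {s : ℂ} (hs : s ∈ U) :
    ‖∏' i, F i s - ∏ i ∈ A, F i s‖
      ≤ Real.exp (∑' i, b i) * (Real.exp (∑' i, ((↑A : Set ι)ᶜ).indicator b i) - 1) := by
  classical
  have hind0 : ∀ i, 0 ≤ ((↑A : Set ι)ᶜ).indicator b i := fun i =>
    Set.indicator_nonneg (fun j _ => hb0 j) i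
  have hind : ∀ i ∉ A, ‖F i s - 1‖ ≤ ((↑A : Set ι)ᶜ).indicator b i := by
    intro i hi
    rw [Set.indicator_of_mem (by simpa using hi)]
    exact hFb i s hs
  have h1 := norm_tprod_sub_prod_le_of_multipliable (multipliable_of_norm_sub_one_le hb hFb hs) A
    hind0 (hb.indicator _) hind
  have hP : ‖∏ i ∈ A, F i s‖ ≤ Real.exp (∑' i, b i) :=
    norm_prod_le_exp_tsum_of_norm_sub_one_le A hb0 hb (fun i _ => hFb i s hs)
  have hT0 : 0 ≤ Real.exp (∑' i, ((↑A : Set ι)ᶜ).indicator b i) - 1 := by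
    have : 0 ≤ ∑' i, ((↑A : Set ι)ᶜ).indicator b i := tsum_nonneg hind0
    linarith [Real.add_one_le_exp (∑' i, ((↑A : Set ι)ᶜ).indicator b i)]
  exact h1.trans (mul_le_mul_of_nonneg_right hP hT0)

end OnSet

/-! ## Continuation between nested half-planes -/

/-- The open right half-plane `{σ₀ < Re s}` is open (plumbing; consumers: `isOpen_lt continuous_const
Complex.continuous_re`). [folklore] -/
private theorem isOpen_halfPlane_re (σ₀ : ℝ) : IsOpen {s : ℂ | σ₀ < s.re} :=
  isOpen_lt continuous_const _root_.Complex.continuous_re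

/-- **Identity theorem between nested half-planes**: if `f` and `g` are holomorphic on `{σ₀ < Re s}`
and agree on `{σ₁ < Re s}` for some `σ₁ ≥ σ₀`, they agree on `{σ₀ < Re s}`. The shape "`𝒰(s)`,
given by a product for `σ > 1`, IS [the holomorphic function] `∏'` on `σ > 9/10`" (identity theorem,
Mathlib `AnalyticOnNhd.eqOn_of_preconnected_of_eventuallyEq`). [cite: Conway1978, IV.3 Corollary 3.8, p. 79] -/
theorem eqOn_of_eqOn_halfPlane {f g : ℂ → ℂ} {σ₀ σ₁ : ℝ} (hσ : σ₀ ≤ σ₁)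
    (hf : DifferentiableOn ℂ f {s : ℂ | σ₀ < s.re}) (hg : DifferentiableOn ℂ g {s : ℂ | σ₀ < s.re})
    (heq : Set.EqOn f g {s : ℂ | σ₁ < s.re}) : Set.EqOn f g {s : ℂ | σ₀ < s.re} := by
  have hU := isOpen_halfPlane_re σ₀
  have hV := isOpen_halfPlane_re σ₁
  have hz₀U : ((σ₁ + 1 : ℝ) : ℂ) ∈ {s : ℂ | σ₀ < s.re} := by
    show σ₀ < ((σ₁ + 1 : ℝ) : ℂ).re; rw [_root_.Complex.ofReal_re]; linarith
  have hz₀V : ((σ₁ + 1 : ℝ) : ℂ) ∈ {s : ℂ | σ₁ < s.re} := by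
    show σ₁ < ((σ₁ + 1 : ℝ) : ℂ).re; rw [_root_.Complex.ofReal_re]; linarith
  exact (hf.analyticOnNhd hU).eqOn_of_preconnected_of_eventuallyEq (hg.analyticOnNhd hU)
    (convex_halfSpace_re_gt σ₀).isPreconnected hz₀U
    (Filter.eventuallyEq_of_mem (hV.mem_nhds hz₀V) heq)

/-- **Continuation packaged**: factors holomorphic on `{σ₀ < Re s}` with a summable majorant there;
any holomorphic `M` on `{σ₀ < Re s}` that agrees with `∏' i, F i s` on `{σ₁ < Re s}` (`σ₁ ≥ σ₀`)
equals `∏' i, F i s` on all of `{σ₀ < Re s}`. [cite: Conway1978, VII.5 Theorem 5.9, p. 167; IV.3 Corollary 3.8] -/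
theorem eqOn_tprod_of_eqOn_halfPlane {ι : Type*} {σ₀ σ₁ : ℝ} (hσ : σ₀ ≤ σ₁)
    {F : ι → ℂ → ℂ} {b : ι → ℝ} (hF : ∀ i, DifferentiableOn ℂ (F i) {s : ℂ | σ₀ < s.re})
    (hb : Summable b) (hFb : ∀ i, ∀ s : ℂ, σ₀ < s.re → ‖F i s - 1‖ ≤ b i)
    {M : ℂ → ℂ} (hM : DifferentiableOn ℂ M {s : ℂ | σ₀ < s.re})
    (hMeq : ∀ s : ℂ, σ₁ < s.re → M s = ∏' i, F i s) :
    Set.EqOn M (fun s => ∏' i, F i s) {s : ℂ | σ₀ < s.re} :=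
  eqOn_of_eqOn_halfPlane hσ hM
    (differentiableOn_tprod_of_norm_sub_one_le (isOpen_halfPlane_re σ₀) hF hb
      (fun i s hs => hFb i s hs))
    (fun s hs => hMeq s hs)

/-! ## Prime-indexed tails `Σ_{q ≥ D} q^{−(a+δ)} ≤ D^{−δ} Σ_q q^{−a}` -/

/-- For `0 < D ≤ x` and `δ ≥ 0`: `x^{−(a+δ)} ≤ D^{−δ}·x^{−a}`. [folklore] -/
private theorem rpow_neg_add_le_mul_rpow_of_le {D x a δ : ℝ} (hD : 0 < D) (hx : D ≤ x) (hδ : 0 ≤ δ) :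
    x ^ (-(a + δ)) ≤ D ^ (-δ) * x ^ (-a) := by
  have hx0 : 0 < x := lt_of_lt_of_le hD hx
  have h1 : x ^ (-δ) ≤ D ^ (-δ) := Real.rpow_le_rpow_of_nonpos hD hx (by linarith)
  rw [neg_add, Real.rpow_add hx0, mul_comm]
  exact mul_le_mul_of_nonneg_right h1 (Real.rpow_nonneg hx0.le _)

/-- `Σ_q q^{−a}` over the primes converges for `a > 1` (Mathlib `Nat.Primes.summable_rpow`). [folklore] -/
private theorem summable_primes_rpow_neg {a : ℝ} (ha : 1 < a) :
    Summable fun q : Nat.Primes => ((q : ℕ) : ℝ) ^ (-a) :=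
  Nat.Primes.summable_rpow.mpr (by linarith)

/-- The prime-tail majorant `q ↦ [q ≥ D]·C·q^{−(a+δ)}` is non-negative (`C ≥ 0`).
[cite: Zhang2022LandauSiegel, App. A p. 101 (tex L4999–5000), generic form] -/
theorem primeTail_nonneg {C a δ : ℝ} (hC : 0 ≤ C) (D : ℕ) (q : Nat.Primes) :
    0 ≤ (if (q : ℕ) < D then (0 : ℝ) else C * ((q : ℕ) : ℝ) ^ (-(a + δ))) := by
  split_ifs
  · exact le_rfl
  · exact mul_nonneg hC (Real.rpow_nonneg (Nat.cast_nonneg _) _)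

/-- The prime-tail majorant is dominated termwise by `C·D^{−δ}·q^{−a}` (`D ≥ 1`, `δ ≥ 0`, `C ≥ 0`).
[folklore] -/
private theorem primeTail_le {C a δ : ℝ} (hC : 0 ≤ C) (hδ : 0 ≤ δ) {D : ℕ} (hD : 0 < D) (q : Nat.Primes) :
    (if (q : ℕ) < D then (0 : ℝ) else C * ((q : ℕ) : ℝ) ^ (-(a + δ))) ≤
      C * (D : ℝ) ^ (-δ) * ((q : ℕ) : ℝ) ^ (-a) := by
  have hD0 : (0 : ℝ) < D := by exact_mod_cast hD
  split_ifs with hq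
  · exact mul_nonneg (mul_nonneg hC (Real.rpow_nonneg hD0.le _)) (Real.rpow_nonneg (Nat.cast_nonneg _) _)
  · have hq' : (D : ℝ) ≤ ((q : ℕ) : ℝ) := by exact_mod_cast not_lt.mp hq
    rw [mul_assoc]
    exact mul_le_mul_of_nonneg_left (rpow_neg_add_le_mul_rpow_of_le hD0 hq' hδ) hC

/-- The prime-tail majorant is summable (`a > 1`) — the `Summable b` input of `norm_tprod_sub_prod_le[_of_multipliable]`
for Euler products with `‖f q − 1‖ ≤ C q^{−(a+δ)}` beyond `D`. [cite: Zhang2022LandauSiegel, App. A p. 101 (tex L4999–5000), generic form] -/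
theorem summable_primeTail {C a δ : ℝ} (hC : 0 ≤ C) (ha : 1 < a) (hδ : 0 ≤ δ) {D : ℕ} (hD : 0 < D) :
    Summable fun q : Nat.Primes =>
      (if (q : ℕ) < D then (0 : ℝ) else C * ((q : ℕ) : ℝ) ^ (-(a + δ))) :=
  Summable.of_nonneg_of_le (fun q => primeTail_nonneg hC D q) (fun q => primeTail_le hC hδ hD q)
    ((summable_primes_rpow_neg ha).mul_left _)

/-- **`Σ_{q ≥ D prime} C·q^{−(a+δ)} ≤ C·D^{−δ}·Σ_q q^{−a}`** — the source of every "`+ O(D^{−c})`"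
truncation error of an Euler product at the primes below `D` (Zhang App. A p.101: "`𝔱_j = 1 + O(q^{−9/5})` for
`σ > 9/10` … and `𝒰_j = λ∏_{q<D}𝔱_j + O(D^{−c})`", generic form). [cite: Zhang2022LandauSiegel, App. A p. 101 (tex L4999–5000), generic form] -/
theorem tsum_primeTail_le {C a δ : ℝ} (hC : 0 ≤ C) (ha : 1 < a) (hδ : 0 ≤ δ) {D : ℕ} (hD : 0 < D) :
    ∑' q : Nat.Primes, (if (q : ℕ) < D then (0 : ℝ) else C * ((q : ℕ) : ℝ) ^ (-(a + δ))) ≤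
      C * (D : ℝ) ^ (-δ) * ∑' q : Nat.Primes, ((q : ℕ) : ℝ) ^ (-a) := by
  rw [← tsum_mul_left]
  exact Summable.tsum_le_tsum (fun q => primeTail_le hC hδ hD q) (summable_primeTail hC ha hδ hD)
    ((summable_primes_rpow_neg ha).mul_left _)

/-- A finite product over the `Finset Nat.Primes` of primes below `D` is the product over
`Nat.primesBelow D` (plumbing). [folklore] -/
private theorem prod_primesBelow_subtype_eq (D : ℕ) (f : ℕ → ℂ) :
    ∏ q ∈ (Nat.primesBelow D).subtype Nat.Prime, f (q : ℕ) = ∏ q ∈ Nat.primesBelow D, f q := by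
  rw [Finset.prod_subtype_eq_prod_filter]
  rw [Finset.filter_true_of_mem fun q hq => Nat.prime_of_mem_primesBelow hq]

/-- Membership in the `Finset Nat.Primes` of primes below `D` (term-mode use: `.mp`/`.mpr`;
`Nat.Primes` is a `def`, so `rw` with this lemma may need `erw`; plumbing). [folklore] -/
private theorem mem_primesBelow_subtype_iff {D : ℕ} {q : Nat.Primes} :
    q ∈ ((Nat.primesBelow D).subtype Nat.Prime : Finset Nat.Primes) ↔ (q : ℕ) < D :=
  ⟨fun h => (Nat.mem_primesBelow.mp (Finset.mem_subtype.mp h)).1,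
    fun h => Finset.mem_subtype.mpr (Nat.mem_primesBelow.mpr ⟨h, q.prop⟩)⟩

/-- **Truncating an Euler product at the primes below `D`.** If `∏'_q f(q)` (over all primes)
converges and `‖f(q) − 1‖ ≤ C·q^{−(a+δ)}` for every prime `q ≥ D` (`a > 1`, `δ ≥ 0`, `C ≥ 0`,
`D ≥ 1`), then
`‖∏'_q f(q) − ∏_{q<D} f(q)‖ ≤ ‖∏_{q<D} f(q)‖ · (exp(C·D^{−δ}·Σ_q q^{−a}) − 1)`
(hence `≪ ‖∏_{q<D} f(q)‖ · D^{−δ}` by Mathlib `Real.abs_exp_sub_one_le`) — the `M`-test tail specialised to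
Euler products, i.e. the generic form of Zhang App. A p.101 "`𝒰_j = λ∏_{q<D}𝔱_j + O(D^{−c})`".
[cite: Conway1978, VII.5 Lemma 5.8, p. 166; Zhang2022LandauSiegel, App. A p. 101] -/
theorem norm_tprod_primes_sub_prod_primesBelow_le {f : ℕ → ℂ}
    (hf : Multipliable fun q : Nat.Primes => f (q : ℕ)) {C a δ : ℝ} (hC : 0 ≤ C) (ha : 1 < a)
    (hδ : 0 ≤ δ) {D : ℕ} (hD : 0 < D)
    (hfb : ∀ q : ℕ, q.Prime → D ≤ q → ‖f q - 1‖ ≤ C * (q : ℝ) ^ (-(a + δ))) :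
    ‖(∏' q : Nat.Primes, f (q : ℕ)) - ∏ q ∈ Nat.primesBelow D, f q‖ ≤
      ‖∏ q ∈ Nat.primesBelow D, f q‖ *
        (Real.exp (C * (D : ℝ) ^ (-δ) * ∑' q : Nat.Primes, ((q : ℕ) : ℝ) ^ (-a)) - 1) := by
  classical
  set S : Finset Nat.Primes := (Nat.primesBelow D).subtype Nat.Prime with hS
  -- the finite product over `S` (index type `Nat.Primes`) is the product over `Nat.primesBelow D`
  have e1 : (∏ q ∈ S, f (q : ℕ)) = ∏ q ∈ Nat.primesBelow D, f q := prod_primesBelow_subtype_eq D f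
  have hFb : ∀ q ∉ S, ‖f (q : ℕ) - 1‖ ≤
      (if (q : ℕ) < D then (0 : ℝ) else C * ((q : ℕ) : ℝ) ^ (-(a + δ))) := by
    intro q hq
    have hqD : ¬ (q : ℕ) < D := fun h => hq (mem_primesBelow_subtype_iff.mpr h)
    rw [if_neg hqD]
    exact hfb q q.prop (not_lt.mp hqD)
  have h := norm_tprod_sub_prod_le_of_multipliable hf S (fun q => primeTail_nonneg hC D q)
    (summable_primeTail hC ha hδ hD) hFb
  rw [e1] at h
  refine h.trans (mul_le_mul_of_nonneg_left ?_ (norm_nonneg _))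
  linarith [Real.exp_le_exp.mpr (tsum_primeTail_le hC ha hδ hD (a := a))]

end Literature.Analysis.Complex

end
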